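import Summits.BirchSwinnertonDyer.BirchSwinnertonDyer.Theorems.KatoDescentTamePotSupersingularTameUpperNonsurjTowerReduction
import Summits.BirchSwinnertonDyer.Rank1Residual.Additive.KodairaDictionaryThree
import HarnessLib

/-!
# Route `KatoDescentTamePotSupersingular` (rung K8, sub-rung B4 (t′), cell `bsd-potss`): the row crux
# `TameUpperNonsurjTower` (U₀-ns, item stmt-BirchSwinnertonDyer-19202) LOSES ITS «SURJECTIVE MOD 3»
# ROWS — the registered stub `stub_nonsurj_surjMod3Tame` is PROVED (vacuously: on (t′) at `3`,
# surj(3) forces the whole `3`-adic tower) and the crux follows UNCONDITIONALLY from the other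
# registered stub `stub_nonsurj_properModP` alone (a `--supports` file)

The tenure planner's child-level skeleton of item 19202 (plan g10, `plan/percrux4/KT_TameUpperNonsurjTower_birth.lean`,
registered 02:31Z) splits the crux by the image MOD `p`: (a) `stub_nonsurj_surjMod3Tame` — the (t′)
rank-`0` rows at `p = 3` with `ρ̄_{E,3}` ONTO but `3`-adic tower not onto (the `p ≥ 5` analogue is
empty by Serre's lifting lemma and is discharged inside its `TameUpperNonsurjTower_of`); (b)
`stub_nonsurj_properModP` — irreducible but PROPER image mod `p`. This file shows that (a) is
EMPTY: the (t′) cell at `3` is exactly Kodaira `III`/`III*` (tame, `f₃ = 2`, `e = 4`), and on every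
X4 row at `3` OUTSIDE the wild cell the census bit surj(3) already gives `ρ̄_{E,3ⁿ}` onto for all `n`
— tree theorem `Additive.ClassX4.towerSurj_three_of_surj_of_subTprime` (b2b cell, team n1011, file
`Additive/KodairaDictionaryThree.lean`, from Wuthrich 2014 Lemma 20's LOCAL proof extended over the
tame additive types; Elkies' 9-deficient images live in the WILD cell `v₃(N) ≥ 3` only,
`ClassX4.subW_of_not_towerSurj_three`). Census cross-check (EVIDENCE, `FINDING-19202-tame-three.md`
on the item; b2b rmap-2 GEN 5 certified img3 census, N < 5·10⁵): 9 910 (t′)-at-3 surj(3) rank-0 X4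
rows, ALL certified SURJ9; the 21 Elkies curves all have `v₃(N) = 5`.

* `stub_nonsurj_surjMod3Tame_holds` — statement = the registered `Sig.stub_nonsurj_surjMod3Tame`
  VERBATIM (binder for binder), proved by contradiction with the tree theorem;
* `tameUpperNonsurjTower_of_properModP` — **the crux BY NAME from stub (b) ALONE** (the planner's
  composition `TameUpperNonsurjTower_of hs hp` with `hs` discharged): `p = 3` surjective rows by the
  theorem above, `p ≥ 5` surjective rows by Serre (`serre_hasSurjectiveModNGaloisRep_pow_holds`);
* `tameUpperNonsurjTower_of_cm_of_properModP_nonCM` — the same with the CM rows of (b) discharged by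
  row C8 (`missingUpperBoundAt_of_hasCM_rankZero`, p418268; named facts: the CM triple, modularity,
  GZK): the crux follows from the upper half on the NON-CM rank-`0` (t′) rows with `E[p]` irreducible
  and `ρ̄_{E,p}` NOT onto — on the census 411 pairs (`p = 3`: 248, image `Nn`; `p = 5`: 160, images
  `Ns/Nn/S4/Ns.2.1/Ns21`; `p = 7`: 3, `Nn`; none at `p ≥ 11`), class-wide infinite.

Nothing about stub (b) or the named facts is asserted; the item is NOT closed. Seat `bsd-potss-k8t-c4`.

References: [Wuthrich2014] Lemma 20 (p. 399); [SerreAbelianLadic1968] IV-23 Lemma 3;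
[SilvermanATAEC1994] IV.9.4, Table 4.1; [BurungaleFlach2024] Thm. 1.1, Cor. 2; [Miller2011LMS] Def. 1.1.
-/

set_option autoImplicit false
-- sibling precedent (`KatoDescentTamePotSupersingularAssembly.lean`): the directory name repeats the summit name
set_option linter.dupNamespace false

noncomputable section

open scoped Classical

namespace Summit.BirchSwinnertonDyer.BirchSwinnertonDyer.Theorems

open WeierstrassCurve Literature.NumberTheory.EllipticCurves
  Literature.NumberTheory.EllipticCurves.Rank1Residual
  Literature.NumberTheory.EllipticCurves.Rank1Residual.Typed
  Summit.BirchSwinnertonDyer.Rank1Residual.Additive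
  Summit.BirchSwinnertonDyer.Rank1Residual
  Summit.BirchSwinnertonDyer.BirchSwinnertonDyer.Theses.KatoDescentTamePotSupersingular

/-- **Stub (a) of item 19202 (`Sig.stub_nonsurj_surjMod3Tame`, registered 2026-08-26T02:31Z), PROVED**
— vacuously: on the (t′) cell at `3` (Kodaira `III`/`III*`) with `E[3]` irreducible, surj(3) gives
the whole `3`-adic tower (`Additive.ClassX4.towerSurj_three_of_surj_of_subTprime`), contradicting
the row's hypothesis that the tower is not onto. Statement binder-for-binder the registered one.
[cite: Wuthrich2014, Lemma 20 (p. 399)] [cite: SilvermanATAEC1994, IV.9.4 and Table 4.1 (PDF pp. 344–346, 365)] -/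
theorem stub_nonsurj_surjMod3Tame_holds :
    ∀ (W : WeierstrassCurve ℚ) [W.IsElliptic] [W.IsGloballyMinimal] [Fact (3 : ℕ).Prime],
      W.analyticRank = 0 → Addv W 3 → SubTprime W 3 → W.HasIrreducibleModPGaloisRep 3 →
      W.HasSurjectiveModNGaloisRep 3 → ¬ (∀ n : ℕ, W.HasSurjectiveModNGaloisRep (3 ^ n : ℕ)) →
        MissingUpperBoundAt W 3 := by
  intro W _ _ _ _ hadd hT hI hsurj hns
  exact absurd (ClassX4.towerSurj_three_of_surj_of_subTprime ⟨by decide, hadd, hI⟩ hT hsurj) hns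

/-- An odd prime other than `3` is at least `5`. [folklore] -/
private theorem five_le_of_prime_of_ne_two_of_ne_three'' {p : ℕ} (hp : p.Prime) (h2 : p ≠ 2)
    (h3 : p ≠ 3) : 5 ≤ p := by
  rcases Nat.lt_or_ge p 5 with h | h
  · have h2le := hp.two_le
    interval_cases p
    · exact absurd rfl h2
    · exact absurd rfl h3
    · exact absurd hp (by decide)
  · exact h

/-- **The row crux `TameUpperNonsurjTower` BY NAME from stub (b) ALONE** (the planner's
composition with stub (a) discharged): on a rank-`0` (t′) row with `E[p]` irreducible and tower not
onto, either `ρ̄_{E,p}` is not onto — stub (b) — or it is onto, and then the tower IS onto: at `p = 3`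
by `Additive.ClassX4.towerSurj_three_of_surj_of_subTprime`, at `p ≥ 5` by Serre's lifting lemma
(`serre_hasSurjectiveModNGaloisRep_pow_holds`) — contradiction. Nothing about (b) is asserted.
[cite: Wuthrich2014, Lemma 20 (p. 399)] [cite: SerreAbelianLadic1968, Ch. IV §3.4 Lemma 3 (IV-23)] -/
theorem tameUpperNonsurjTower_of_properModP
    (hb : ∀ (W : WeierstrassCurve ℚ) [W.IsElliptic] [W.IsGloballyMinimal] (p : ℕ) [Fact p.Prime],
      W.analyticRank = 0 → p ≠ 2 → Addv W p → SubTprime W p → W.HasIrreducibleModPGaloisRep p →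
      ¬ W.HasSurjectiveModNGaloisRep p → MissingUpperBoundAt W p) :
    Summit.BirchSwinnertonDyer.BirchSwinnertonDyer.Theses.KatoDescentTamePotSupersingular.TameUpperNonsurjTower := by
  intro W _ _ p _ hr hp2 hadd hT hI hns
  by_cases hsp : W.HasSurjectiveModNGaloisRep p
  · by_cases h3 : p = 3
    · subst h3
      exact stub_nonsurj_surjMod3Tame_holds W hr hadd hT hI hsp hns
    · exact absurd (serre_hasSurjectiveModNGaloisRep_pow_holds W p
        (five_le_of_prime_of_ne_two_of_ne_three'' Fact.out hp2 h3) hsp) hns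
  · exact hb W p hr hp2 hadd hT hI hsp

/-- **The row crux BY NAME from the NON-CM rows of stub (b)** (granted the CM triple of row C8 —
Rubin 1991 / Burungale–Flach 2024 —, modularity and GZK for the CM rows,
`missingUpperBoundAt_of_hasCM_rankZero`): `TameUpperNonsurjTower` follows from the upper half on the
NON-CM rank-`0` (t′) rows with `E[p]` irreducible and `ρ̄_{E,p}` not onto (census: 411 pairs at
`p ∈ {3,5,7}`, images `Nn/Ns/S4`). Nothing about those rows or the named facts is asserted.
[cite: Wuthrich2014, Lemma 20 (p. 399)] [cite: SerreAbelianLadic1968, Ch. IV §3.4 Lemma 3 (IV-23)]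
[cite: BurungaleFlach2024, Thm. 1.1 and Cor. 2 (p. 4)] -/
theorem tameUpperNonsurjTower_of_cm_of_properModP_nonCM (hCM : bsdTriple_of_hasCM_of_L_one_ne_zero)
    (hmod : hasEntireLFunction_rat) (hGZK : rank_eq_analyticRank_of_analyticRank_le_one)
    (hb : ∀ (W : WeierstrassCurve ℚ) [W.IsElliptic] [W.IsGloballyMinimal] (p : ℕ) [Fact p.Prime],
      W.analyticRank = 0 → p ≠ 2 → Addv W p → SubTprime W p → ¬ W.HasCM →
      W.HasIrreducibleModPGaloisRep p → ¬ W.HasSurjectiveModNGaloisRep p → MissingUpperBoundAt W p) :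
    Summit.BirchSwinnertonDyer.BirchSwinnertonDyer.Theses.KatoDescentTamePotSupersingular.TameUpperNonsurjTower :=
  tameUpperNonsurjTower_of_properModP fun W _ _ p _ hr hp2 hadd hT hI hsp ↦ by
    by_cases hcm : W.HasCM
    · exact missingUpperBoundAt_of_hasCM_rankZero hCM hmod hGZK W p hr hcm
    · exact hb W p hr hp2 hadd hT hcm hI hsp

end Summit.BirchSwinnertonDyer.BirchSwinnertonDyer.Theorems

end
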